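/-
Copyright (c) 2026. All rights reserved.
Released under Apache 2.0 license as described in the file LICENSE.
-/
import Literature.AlgebraicGeometry.VanGeemen1994.WeilDiscriminantOfProductTop
import Literature.AlgebraicGeometry.VanGeemen1994.WeilDiscriminantSign
import Literature.AlgebraicGeometry.VanGeemen1994.WeilKFrame
import Literature.AlgebraicGeometry.Motives.AimedSplitProductDischarge
import Literature.AlgebraicGeometry.Motives.HyperbolicWeilTypeProductModel
import Literature.AlgebraicGeometry.Motives.SegreHyperplaneClass
import Literature.AlgebraicGeometry.Motives.AbelianVarietyProductDimProofs
import Literature.AlgebraicGeometry.HodgeTheory.WeilSurfaceCMSquareModel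
import HarnessLib

/-!
# A fourfold `(Y, φ)` times the square of a CM curve `(E × E, ψ × ψ)` with the SAME-SIGN action: the discriminant of the weighted
# product polarizations, its sign, and — when `(Y × (E × E), φ × (ψ × ψ))` is of Weil type `(3, d)` — SPLIT Weil type
# (Markman's product trick, arXiv:2509.23403 §11.5 Step 2, with van Geemen's `det H` (LNM 1594, 5.2) and Landherr; our formalisation)

Layer `Literature/AlgebraicGeometry/VanGeemen1994`; theorems only (no definition, no named fact, no `sorry`).  The tree already
formalises «the discriminant invariant … is multiplicative under cartesian products» (`hasWeilDiscriminantNondeg_prod_of_kFrames`,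
`prod_kFrames_top_ne_zero`), the `K`-frame of a `K`-symmetrised hyperplane class (`exists_kFrame_ksymm`), the `K`-symmetric weighted
Segre embedding of `A × (E × E)` (`Motives.exists_symmetricSegreEmbedding`), the rational model of a CM curve
(`HodgeTheory.cmCurve_rationalModel`), the sign `(-1)ⁿ det H > 0` for Weil type (`neg_one_pow_mul_pos_of_hasWeilDiscriminantNondeg_of_isWeilType`)
and Landherr's criterion in the form `[(-1)ⁿ t²] ⟹ split` (`isSplitWeilType_of_hasWeilDiscriminantNondeg_sq`).  Markman's aiming step
(§11.5 Step 2) pairs a Weil-type FOURFOLD with a Weil-type SURFACE; the tree's `Motives/AimedSplitProduct*` implements it with the CM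
square `E₀ × E₀` carrying the OPPOSITE-sign action `ψ₀ × (-ψ₀)`.  Here the partner square carries the SAME-sign action `ψ × ψ` and `Y`
need not be of Weil type (in the application `Y = Y_{40}` has `K`-multiplicities `(1, 3)` and `E × E` has `(2, 0)`); what makes the
product aimable is that the `K`-Hermitian line of `(E, ψ)` rescales by every positive integer (the weights `m₁, m₂` of the Segre
embedding), so the discriminant class of the sixfold runs through `[R² · q · m₁ m₂]` for a FIXED `q ∈ ℚˣ` — and `q < 0` once the
sixfold is of Weil type `(3, d)`, whence `m₁ = |num q| · den q`, `m₂ = 1` gives the class `[(-1)³ t²]`.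

## What is proved

* `cmSquare_kFrame` — the `K`-frame `(pr₁^* u₀, pr₂^* u₀)` of `(E × E, ψ × ψ)` for the weighted class `pr₁^*(c₁ η) + pr₂^*(c₂ η)`
  (`η` the rational top class of the CM-curve model): Gram data `diag(c₂, c₁)`, `0`, top coefficient `2 c₁ c₂`, and `ψ^* η = d η`.
* **`exists_hasWeilDiscriminantNondeg_fourfold_prod_cmSquare`** — for `dim Y = 4`, `φ ≫ φ = -d`, `dim E = 1`, `ψ ≫ ψ = -d` (`d ≥ 1`):
  a unit `q` such that for all weights `m₁, m₂ ≥ 1` there are a projective embedding `e` of `Y × (E × E)`, a rational `a ≠ 0` and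
  `R ≠ 0` with a NON-DEGENERATE discriminant witness of the `K`-symmetrised hyperplane class `d·e^*a + (φ × (ψ × ψ))^*e^*a` of class
  `[R² · q · m₁ m₂]`.
* **`isSplitWeilType_fourfold_prod_cmSquare`** — if moreover `(Y × (E × E), φ × (ψ × ψ))` is of Weil type `(3, d)`, it is of SPLIT
  Weil type (`q < 0` by the sign lemma at `m₁ = m₂ = 1`; then `m₁ = |num q| · den q`).

## References

* [Markman2025SurveySecant] E. Markman, arXiv:2509.23403, §11.5 Step 2 («the discriminant invariant … is multiplicative under cartesian
  products»; the aiming with a Weil-type surface). [cite: Markman2025SurveySecant, §11.5 Step 2]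
* [vanGeemen1994HodgeAV] B. van Geemen, LNM 1594 (1994), 4.9, Lemma 5.2 (2)–(3), 5.3, 5.4 and (5.4.1). [cite: vanGeemen1994HodgeAV, Lemma 5.2 (2)–(3) and 5.4]
* [Landherr1936HermitianForms] W. Landherr, Abh. Math. Sem. Hamburg 11 (1936). [cite: Landherr1936HermitianForms]
* [Hartshorne1977] R. Hartshorne, *Algebraic Geometry*, II Ex. 5.11–5.12 (Segre, `d`-uple). [cite: Hartshorne1977, II Ex. 5.11 and Ex. 5.12]
* [MoonenZarhin1999LowDim] B. Moonen, Yu. Zarhin, Math. Ann. 315 (1999), §5 Case 2 (the application). [cite: MoonenZarhin1999LowDim, §5 Case 2]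

## Provenance

Cell `pub-hodgecm2` (COR-CM), KEPT Literature lane `lit-deligne-3` gen 58 (claim MZ99-J40-SPLIT-DATUM; count-neutral, own lane), file F58g.
-/

noncomputable section

open CategoryTheory Polynomial Module
open scoped Matrix
open Literature.AlgebraicTopology.SingularHomology
open Literature.AlgebraicGeometry.HodgeTheory
open Literature.AlgebraicGeometry.Motives
open Literature.Geometry.Kaehler

namespace Literature.AlgebraicGeometry.VanGeemen1994

/-! ## §1 The `K`-frame of the CM square `(E × E, ψ × ψ)` for a weighted product class -/

section CMSquare

variable {d : ℕ} {E : AbelianVariety ℂ} {ψ : E ⟶ E}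

/-- **The `K`-frame of the same-sign CM square.**  For a complex elliptic curve `E` with `ψ ≫ ψ = -d` (`d ≥ 1`): the rational top
class `η` of the CM-curve model (`HodgeTheory.cmCurve_rationalModel`: `u = (u₀, u₁ = ψ^*u₀)`, `u₀ ⌣ u₁ = η`, `ψ^* η = d η`), the
frame `x = (pr₁^* u₀, pr₂^* u₀)` of `H¹(E × E)` — rational, with `{x, (ψ × ψ)^* x}` independent — the rational top class
`ω = pr₁^* η ⌣ pr₂^* η ≠ 0`, and for all weights `c₁, c₂ ∈ ℚ` the Gram data of the class `h = pr₁^*(c₁ η) + pr₂^*(c₂ η)` in exponent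
`1`: `Q_h(xᵢ, (ψ × ψ)^* xⱼ) = diag(c₂, c₁)ᵢⱼ · ω`, `Q_h(xᵢ, xⱼ) = 0`, and `h² = 2 c₁ c₂ · ω` (the block Gram matrix of a product class,
`Motives.polarizationPairingOne_sumElim`, `lefschetzPow_add_map_self`). [cite: vanGeemen1994HodgeAV, Lemma 5.2 (2)–(3) and 5.3]
[cite: Markman2025SurveySecant, §11.5 Step 2] -/
theorem cmSquare_kFrame (hd : 0 < d) (hE : E.dim = 1) (hψ : ψ ≫ ψ = -(d • 𝟙 E)) :
    ∃ (η : complexBetti E.X 2) (x : Fin 2 → complexBetti (E.prod E).X 1) (ω : complexBetti (E.prod E).X (2 + 2 * 1)),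
      IsRationalClass η ∧ η ≠ 0 ∧ complexBetti.map ψ.hom.hom.hom 2 η = (d : ℂ) • η ∧
      (∀ i, IsRationalClass (x i)) ∧
      LinearIndependent ℂ (Sum.elim x (fun i => complexBetti.map
        (AbelianVariety.prodLift (AbelianVariety.fst E E ≫ ψ) (AbelianVariety.snd E E ≫ ψ)).hom.hom.hom 1 (x i))) ∧
      IsRationalClass ω ∧ ω ≠ 0 ∧
      ∀ c₁ c₂ : ℚ,
        (∀ i j, polarizationPairingOne (E.prod E).X
              (complexBetti.map (AbelianVariety.fst E E).hom.hom.hom 2 (((c₁ : ℚ) : ℂ) • η) +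
                complexBetti.map (AbelianVariety.snd E E).hom.hom.hom 2 (((c₂ : ℚ) : ℂ) • η)) 1 (x i)
              (complexBetti.map (AbelianVariety.prodLift (AbelianVariety.fst E E ≫ ψ) (AbelianVariety.snd E E ≫ ψ)).hom.hom.hom 1
                (x j)) = ((!![c₂, 0; 0, c₁] i j : ℚ) : ℂ) • ω ∧
            polarizationPairingOne (E.prod E).X
              (complexBetti.map (AbelianVariety.fst E E).hom.hom.hom 2 (((c₁ : ℚ) : ℂ) • η) +
                complexBetti.map (AbelianVariety.snd E E).hom.hom.hom 2 (((c₂ : ℚ) : ℂ) • η)) 1 (x i) (x j) =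
              (((0 : Matrix (Fin 2) (Fin 2) ℚ) i j : ℚ) : ℂ) • ω) ∧
        lefschetzPow (complexBetti.map (AbelianVariety.fst E E).hom.hom.hom 2 (((c₁ : ℚ) : ℂ) • η) +
              complexBetti.map (AbelianVariety.snd E E).hom.hom.hom 2 (((c₂ : ℚ) : ℂ) • η)) 1 2
            (complexBetti.map (AbelianVariety.fst E E).hom.hom.hom 2 (((c₁ : ℚ) : ℂ) • η) +
              complexBetti.map (AbelianVariety.snd E E).hom.hom.hom 2 (((c₂ : ℚ) : ℂ) • η)) =
          ((2 * c₁ * c₂ : ℚ) : ℂ) • ω := by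
  classical
  have hE' : E.dim = 0 + 1 := hE
  have hX : IsSmoothProjective (0 + 1) E.X := isSmoothProjective_of_dim_eq' hE'
  obtain ⟨u, η, hur, hui, -, hMx, -, hηr, hη0, hgram, -, hψ2, -⟩ := cmCurve_rationalModel hE hd hψ
  -- `ψ^* u₀ = u₁`
  have hψu0 : complexBetti.map ψ.hom.hom.hom 1 (u 0) = u 1 := by
    rw [hMx 0, Fin.sum_univ_two]
    simp
  set f := (AbelianVariety.fst E E).hom.hom.hom with hf
  set g := (AbelianVariety.snd E E).hom.hom.hom with hg
  set Ψ := AbelianVariety.prodLift (AbelianVariety.fst E E ≫ ψ) (AbelianVariety.snd E E ≫ ψ) with hΨ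
  have hΨf : ∀ y, complexBetti.map Ψ.hom.hom.hom 1 (complexBetti.map f 1 y) = complexBetti.map f 1 (complexBetti.map ψ.hom.hom.hom 1 y) :=
    fun y => map_prodLift_map_fst ψ ψ 1 y
  have hΨg : ∀ y, complexBetti.map Ψ.hom.hom.hom 1 (complexBetti.map g 1 y) = complexBetti.map g 1 (complexBetti.map ψ.hom.hom.hom 1 y) :=
    fun y => map_prodLift_map_snd ψ ψ 1 y
  -- the product frame `S = (f^* uᵢ)_i ⊔ (g^* u_k)_k` and its independence
  set S : Fin 2 ⊕ Fin 2 → complexBetti (E.prod E).X 1 :=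
    Sum.elim (fun i => complexBetti.map f 1 (u i)) (fun k => complexBetti.map g 1 (u k)) with hS
  have hSi : LinearIndependent ℂ S := linearIndependent_sumElim_map_fst_map_snd hui hui
  -- the `K`-frame
  let x : Fin 2 → complexBetti (E.prod E).X 1 := ![complexBetti.map f 1 (u 0), complexBetti.map g 1 (u 0)]
  have hx0 : x 0 = complexBetti.map f 1 (u 0) := rfl
  have hx1 : x 1 = complexBetti.map g 1 (u 0) := rfl
  have hΨx0 : complexBetti.map Ψ.hom.hom.hom 1 (x 0) = complexBetti.map f 1 (u 1) := by rw [hx0, hΨf, hψu0]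
  have hΨx1 : complexBetti.map Ψ.hom.hom.hom 1 (x 1) = complexBetti.map g 1 (u 1) := by rw [hx1, hΨg, hψu0]
  -- it is the product frame re-indexed
  let σ : Fin 2 ⊕ Fin 2 → Fin 2 ⊕ Fin 2 := Sum.elim ![Sum.inl 0, Sum.inr 0] ![Sum.inl 1, Sum.inr 1]
  have hσ : Function.Injective σ := by decide
  have hxS : Sum.elim x (fun i => complexBetti.map Ψ.hom.hom.hom 1 (x i)) = S ∘ σ := by
    funext s
    rcases s with i | i <;> fin_cases i
    · rfl
    · rfl
    · exact hΨx0
    · exact hΨx1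
  -- the top class
  set ω : complexBetti (E.prod E).X (2 + 2 * 1) :=
    cupProduct (by norm_num : (2 + 2 * 0) + (2 + 2 * 0) = 2 + 2 * 1) (complexBetti.map f (2 + 2 * 0) η)
      (complexBetti.map g (2 + 2 * 0) η) with hω
  refine ⟨η, x, ω, hηr, hη0, hψ2 η, ?_, ?_, (hηr.map _).cup _ (hηr.map _),
    cupProduct_map_fst_map_snd_ne_zero_of_add_eq hX hX _ (by norm_num) hη0 hη0, fun c₁ c₂ => ⟨?_, ?_⟩⟩
  · intro i
    fin_cases i
    · exact (hur 0).map _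
    · exact (hur 0).map _
  · rw [hxS]
    exact hSi.comp σ hσ
  · -- the Gram data, read off the block Gram matrix of the product frame
    have hG : ∀ (c : ℚ) (i k : Fin 2), polarizationPairingOne E.X (((c : ℚ) : ℂ) • η) 0 (u i) (u k) =
        ((!![(0 : ℚ), 1; -1, 0] i k : ℚ) : ℂ) • η := fun c i k => hgram _ i k
    have key := fun s t => polarizationPairingOne_sumElim (A := E) (B := E) hE' hE' (m := 1) (by norm_num) u u
      (((c₁ : ℚ) : ℂ) • η) η !![(0 : ℚ), 1; -1, 0] (hG c₁) c₁ (af_top_curve η c₁)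
      (((c₂ : ℚ) : ℂ) • η) η !![(0 : ℚ), 1; -1, 0] (hG c₂) c₂ (af_top_curve η c₂) s t
    refine Fin.forall_fin_two.2 ⟨Fin.forall_fin_two.2 ⟨⟨?_, ?_⟩, ⟨?_, ?_⟩⟩, Fin.forall_fin_two.2 ⟨⟨?_, ?_⟩, ⟨?_, ?_⟩⟩⟩
    · rw [hΨx0, hx0]
      refine (key (Sum.inl 0) (Sum.inl 1)).trans ?_
      congr 1
      simp
    · rw [hx0]
      refine (key (Sum.inl 0) (Sum.inl 0)).trans ?_
      congr 1
      simp
    · rw [hΨx1, hx0]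
      refine (key (Sum.inl 0) (Sum.inr 1)).trans ?_
      congr 1
    · rw [hx0, hx1]
      refine (key (Sum.inl 0) (Sum.inr 0)).trans ?_
      congr 1
    · rw [hΨx0, hx1]
      refine (key (Sum.inr 0) (Sum.inl 1)).trans ?_
      congr 1
    · rw [hx1, hx0]
      refine (key (Sum.inr 0) (Sum.inl 0)).trans ?_
      congr 1
    · rw [hΨx1, hx1]
      refine (key (Sum.inr 0) (Sum.inr 1)).trans ?_
      congr 1
      simp
    · rw [hx1]
      refine (key (Sum.inr 0) (Sum.inr 0)).trans ?_
      congr 1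
      simp
  · -- the top power
    refine (lefschetzPow_add_map_self (A := E) (B := E) hE' hE' (m := 1) (by norm_num)
      (((c₁ : ℚ) : ℂ) • η) η c₁ (af_top_curve η c₁) (((c₂ : ℚ) : ℂ) • η) η c₂ (af_top_curve η c₂)).trans ?_
    congr 1

end CMSquare

/-! ## §2 The discriminant of the weighted product polarizations of `Y × (E × E)` -/

section FourfoldTimesCMSquare

variable {d : ℕ} {Y E : AbelianVariety ℂ} {φ : Y ⟶ Y} {ψ : E ⟶ E}

/-- The Gram determinant of the diagonal `K`-frame of the CM square: `det diag(c₂, c₁) = c₁ c₂`. [cite: vanGeemen1994HodgeAV, Lemma 5.2 (2)] -/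
private theorem det_weilGramMatrix_diag (d : ℕ) (c₁ c₂ : ℚ) (hc : c₁ * c₂ ≠ 0) :
    (weilGramMatrix d !![c₂, 0; 0, c₁] 0).det = algebraMap ℚ (weilField d) ((Units.mk0 (c₁ * c₂) hc : ℚˣ) : ℚ) := by
  rw [Matrix.det_fin_two, weilGramMatrix_apply, weilGramMatrix_apply, weilGramMatrix_apply, weilGramMatrix_apply, Units.val_mk0]
  simp only [Matrix.zero_apply, map_zero, zero_mul, add_zero, Matrix.of_apply, Matrix.cons_val', Matrix.cons_val_zero,
    Matrix.cons_val_one, Matrix.cons_val_fin_one, Matrix.empty_val', sub_zero, mul_zero, ← map_mul, mul_comm c₂ c₁]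

/-- **THE DISCRIMINANT OF `Y × (E × E)` FOR THE WEIGHTED PRODUCT POLARIZATIONS** (Markman's product trick with a same-sign CM
square).  For `dim Y = 4`, `φ ≫ φ = -d`, a complex elliptic curve `E` with `ψ ≫ ψ = -d` (`d ≥ 1`): there is a unit `q ∈ ℚˣ` (the
Gram determinant of the `K`-symmetrised hyperplane class of a `K`-symmetric embedding of `Y`) such that for all weights
`m₁, m₂ ≥ 1` the `K`-symmetric weighted Segre embedding `e` of `Y × (E × E)` (`Motives.exists_symmetricSegreEmbedding`) has a
NON-DEGENERATE discriminant witness, for the `K`-symmetrised hyperplane class `d·e^*a + (φ × (ψ × ψ))^*e^*a` in half-dimension `3`,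
of class `[u]` with `u = R² · q · m₁ m₂`, `R ≠ 0` («the discriminant invariant … is multiplicative under cartesian products»: the
tree's `hasWeilDiscriminantNondeg_prod_of_kFrames` on the `K`-frames of `Y` (`exists_kFrame_ksymm`) and of `E × E`
(`cmSquare_kFrame`), the top coefficients being non-zero by `prod_kFrames_top_ne_zero`).
[cite: Markman2025SurveySecant, §11.5 Step 2] [cite: vanGeemen1994HodgeAV, Lemma 5.2 (2)–(3) and 5.3]
[cite: Hartshorne1977, II Ex. 5.11 and Ex. 5.12] -/
theorem exists_hasWeilDiscriminantNondeg_fourfold_prod_cmSquare (hd : 0 < d) (hY : Y.dim = 4) (hφ : φ ≫ φ = -(d • 𝟙 Y))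
    (hE : E.dim = 1) (hψ : ψ ≫ ψ = -(d • 𝟙 E)) :
    ∃ q : ℚˣ, ∀ m₁ m₂ : ℕ, 0 < m₁ → 0 < m₂ →
      ∃ (e : ProjectiveEmbedding (Y.prod (E.prod E)).X) (a : complexBetti (projectiveSpace e.n ℂ) 2) (u : ℚˣ) (R : ℚ),
        R ≠ 0 ∧ (u : ℚ) = R ^ 2 * ((q : ℚ) * m₁ * m₂) ∧ IsRationalClass a ∧ a ≠ 0 ∧
        HasWeilDiscriminantNondeg (Y.prod (E.prod E))
          (AbelianVariety.prodLift (AbelianVariety.fst Y (E.prod E) ≫ φ)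
            (AbelianVariety.snd Y (E.prod E) ≫
              AbelianVariety.prodLift (AbelianVariety.fst E E ≫ ψ) (AbelianVariety.snd E E ≫ ψ))) 3 d
          ((d : ℂ) • complexBetti.map e.ι 2 a +
            complexBetti.map (AbelianVariety.prodLift (AbelianVariety.fst Y (E.prod E) ≫ φ)
              (AbelianVariety.snd Y (E.prod E) ≫
                AbelianVariety.prodLift (AbelianVariety.fst E E ≫ ψ) (AbelianVariety.snd E E ≫ ψ))).hom.hom.hom 2
              (complexBetti.map e.ι 2 a))
          (QuotientGroup.mk u) := by
  classical
  have hY' : Y.dim = 3 + 1 := hY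
  have hE' : E.dim = 0 + 1 := hE
  have hEE : (E.prod E).dim = 1 + 1 := by rw [AbelianVariety.dim_prod, hE]
  have hdQ : (d : ℚ) ≠ 0 := by exact_mod_cast hd.ne'
  -- §1: the `K`-frame of the CM square
  obtain ⟨η, xB, ωB, hηr, hη0, hψη, hxB, hiB, hωBr, hωB0, hGram⟩ := cmSquare_kFrame hd hE hψ
  -- the `K`-symmetric Segre data for `η`
  obtain ⟨eA, aA, s, haA, haA0, hsym, hemb⟩ := exists_symmetricSegreEmbedding hd hφ E hE η hηr hη0
  -- the `K`-frame of `Y` for the `K`-symmetrised hyperplane class `h_K = d·e_A^*a_A + φ^*e_A^*a_A`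
  obtain ⟨x, ωY, am, bm, qY, t, hx, hiY, hωYr, hωY0, hpY, hdet, ht⟩ :=
    exists_kFrame_ksymm (m := 3) (by norm_num) hY' hd hφ eA haA haA0
  set hKY : complexBetti Y.X 2 :=
    (d : ℂ) • complexBetti.map eA.ι 2 aA + complexBetti.map φ.hom.hom.hom 2 (complexBetti.map eA.ι 2 aA) with hKYdef
  set ΨEE := AbelianVariety.prodLift (AbelianVariety.fst E E ≫ ψ) (AbelianVariety.snd E E ≫ ψ) with hΨEEdef
  have hΨEE : ΨEE ≫ ΨEE = -(d • 𝟙 (E.prod E)) := prodLift_comp_self_eq_neg_nsmul hψ hψ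
  refine ⟨qY, fun m₁ m₂ hm₁ hm₂ => ?_⟩
  obtain ⟨e, a, ha, ha0, he⟩ := hemb m₁ m₂ hm₁ hm₂
  -- the weights of the two curve classes in the `K`-symmetrised class
  set c₁ : ℚ := 2 * d * s * m₁ with hc₁
  set c₂ : ℚ := 2 * d * s * m₂ with hc₂
  obtain ⟨hpB, hdB⟩ := hGram c₁ c₂
  set hB2 : complexBetti (E.prod E).X 2 :=
    complexBetti.map (AbelianVariety.fst E E).hom.hom.hom 2 (((c₁ : ℚ) : ℂ) • η) +
      complexBetti.map (AbelianVariety.snd E E).hom.hom.hom 2 (((c₂ : ℚ) : ℂ) • η) with hB2def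
  -- the `K`-symmetrised hyperplane class of `e` is the product class `pr_Y^* h_K + pr_{E×E}^* h_B`
  have hCI : (d : ℂ) • complexBetti.map e.ι 2 a +
      complexBetti.map (AbelianVariety.prodLift (AbelianVariety.fst Y (E.prod E) ≫ φ)
        (AbelianVariety.snd Y (E.prod E) ≫ ΨEE)).hom.hom.hom 2 (complexBetti.map e.ι 2 a) =
      complexBetti.map (AbelianVariety.fst Y (E.prod E)).hom.hom.hom 2 hKY +
        complexBetti.map (AbelianVariety.snd Y (E.prod E)).hom.hom.hom 2 hB2 := by
    rw [he, hKYdef, hB2def, hΨEEdef]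
    simp only [map_add, map_smul, smul_add]
    rw [map_prodLift_map_fst φ, map_prodLift_map_snd φ, map_prodLift_map_snd φ, map_prodLift_map_fst ψ ψ,
      map_prodLift_map_snd ψ ψ, hψη]
    simp only [map_smul, hc₁, hc₂]
    push_cast
    module
  -- the top coefficients `t = h_K⁴/ω_Y` and `2 c₁ c₂ = h_B²/ω_B` are non-zero (non-degeneracy of `Q_{h_K(e)}`)
  obtain ⟨ht0, hdB0⟩ := prod_kFrames_top_ne_zero hY' hEE (N := 3) (by norm_num) (kA := 3 + 1) (kB := 2) (by norm_num)
    (by norm_num) (by norm_num) hd hφ hΨEE x hx hiY hKY ωY am bm hpY t ht xB hxB hiB hB2 ωB !![c₂, 0; 0, c₁] 0 hpB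
    (2 * c₁ * c₂) hdB e ha ha0 hCI
  have hc : c₁ * c₂ ≠ 0 := by
    intro h
    apply hdB0
    rw [mul_assoc, h, mul_zero]
  have hs : s ≠ 0 := by
    intro h0
    apply hc
    rw [hc₁, h0]
    ring
  -- «det H is multiplicative»: the product witness
  have W := hasWeilDiscriminantNondeg_prod_of_kFrames hY' hEE (N := 3) (by norm_num)
    (finSumFinEquiv : Fin (3 + 1) ⊕ Fin 2 ≃ Fin (2 * 3)) x hx hiY hKY ωY hωYr hωY0 am bm hpY t ht ht0 qY hdet
    xB hxB hiB hB2 ωB hωBr hωB0 !![c₂, 0; 0, c₁] 0 hpB (2 * c₁ * c₂) hdB hdB0 (Units.mk0 (c₁ * c₂) hc)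
    (det_weilGramMatrix_diag d c₁ c₂ hc)
  rw [← hCI] at W
  refine ⟨e, a, _, ((((2 * 3 - 1).choose 3 : ℕ) : ℚ) * (2 * c₁ * c₂)) ^ 2 * ((((2 * 3 - 1).choose (3 + 1) : ℕ) : ℚ) * t) *
    (2 * d * s), ?_, ?_, ha, ha0, W⟩
  · refine mul_ne_zero (mul_ne_zero (pow_ne_zero _ (mul_ne_zero ?_ hdB0)) (mul_ne_zero ?_ ht0))
      (mul_ne_zero (mul_ne_zero two_ne_zero hdQ) hs)
    · exact_mod_cast (Nat.choose_pos (by norm_num : 3 ≤ 2 * 3 - 1)).ne'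
    · exact_mod_cast (Nat.choose_pos (by norm_num : 3 + 1 ≤ 2 * 3 - 1)).ne'
  · simp only [Units.val_mul, Units.val_mk0, hc₁, hc₂]
    ring

end FourfoldTimesCMSquare

/-! ## §3 Weil type `(3, d)` forces `q < 0`; the weight `m₁ = |num q| · den q` then gives the class `[(-1)³ t²]`: SPLIT Weil type -/

section Split

variable {d : ℕ} {Y E : AbelianVariety ℂ} {φ : Y ⟶ Y} {ψ : E ⟶ E}

/-- `q · (|num q| · den q) = -(num q)²` for a negative rational `q`. [folklore] -/
private theorem mul_natAbs_num_mul_den_eq_neg_sq {q : ℚ} (hq : q < 0) :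
    q * ((q.num.natAbs * q.den : ℕ) : ℚ) = -((q.num.natAbs : ℚ)) ^ 2 := by
  have hnum : (q.num : ℚ) < 0 := by exact_mod_cast Rat.num_neg.2 hq
  have habs : ((q.num.natAbs : ℕ) : ℚ) = -(q.num : ℚ) := by
    rw [Nat.cast_natAbs, Int.cast_abs, abs_of_neg hnum]
  rw [Nat.cast_mul, habs, ← mul_assoc, mul_comm q, mul_assoc, Rat.mul_den_eq_num]
  ring

/-- **SPLIT WEIL TYPE OF `Y × (E × E)`** (Markman's product trick with a same-sign CM square; van Geemen 5.4 (5.4.1); Landherr).  If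
`dim Y = 4`, `φ ≫ φ = -d`, `E` is a complex elliptic curve with `ψ ≫ ψ = -d` (`d ≥ 1`), and the sixfold `(Y × (E × E), φ × (ψ × ψ))`
is of Weil type `(3, d)`, then it is of SPLIT Weil type: by `exists_hasWeilDiscriminantNondeg_fourfold_prod_cmSquare` its weighted
product polarizations have discriminant classes `[R² · q · m₁ m₂]` for a fixed unit `q`; the sign lemma for Weil type
(`neg_one_pow_mul_pos_of_hasWeilDiscriminantNondeg_of_isWeilType`, at `m₁ = m₂ = 1`) gives `q < 0`; the weights
`m₁ = |num q| · den q`, `m₂ = 1` give the class `[(-1)³ (R · num q)²]`, and `t² = Nm(t)` (`isSplitWeilType_of_hasWeilDiscriminantNondeg_sq`).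
[cite: Markman2025SurveySecant, §11.5 Step 2] [cite: vanGeemen1994HodgeAV, 5.4 and (5.4.1)] [cite: Landherr1936HermitianForms] -/
theorem isSplitWeilType_fourfold_prod_cmSquare (hd : 0 < d) (hY : Y.dim = 4) (hφ : φ ≫ φ = -(d • 𝟙 Y)) (hE : E.dim = 1)
    (hψ : ψ ≫ ψ = -(d • 𝟙 E))
    (hW : IsWeilType (Y.prod (E.prod E))
      (AbelianVariety.prodLift (AbelianVariety.fst Y (E.prod E) ≫ φ)
        (AbelianVariety.snd Y (E.prod E) ≫
          AbelianVariety.prodLift (AbelianVariety.fst E E ≫ ψ) (AbelianVariety.snd E E ≫ ψ))) 3 d) :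
    IsSplitWeilType (Y.prod (E.prod E))
      (AbelianVariety.prodLift (AbelianVariety.fst Y (E.prod E) ≫ φ)
        (AbelianVariety.snd Y (E.prod E) ≫
          AbelianVariety.prodLift (AbelianVariety.fst E E ≫ ψ) (AbelianVariety.snd E E ≫ ψ))) 3 d := by
  obtain ⟨q, hq⟩ := exists_hasWeilDiscriminantNondeg_fourfold_prod_cmSquare hd hY hφ hE hψ
  -- the sign of the discriminant of a Weil-type pair: `(-1)³ · (R² q) > 0`, so `q < 0`
  have hneg : (q : ℚ) < 0 := by
    obtain ⟨e, a, u, R, hR, hu, ha, ha0, hδ⟩ := hq 1 1 one_pos one_pos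
    have hs := neg_one_pow_mul_pos_of_hasWeilDiscriminantNondeg_of_isWeilType hW e ha ha0 hδ
    rw [hu] at hs
    have hR2 : 0 < R ^ 2 := by positivity
    norm_num at hs
    nlinarith
  -- the aimed weights `m₁ = |num q| · den q`, `m₂ = 1`
  have hn : 0 < (q : ℚ).num.natAbs * (q : ℚ).den :=
    Nat.mul_pos (Int.natAbs_pos.2 (Rat.num_ne_zero.2 hneg.ne)) (q : ℚ).den_pos
  obtain ⟨e, a, u, R, hR, hu, ha, ha0, hδ⟩ := hq _ 1 hn one_pos
  have hN : ((q : ℚ).num.natAbs : ℚ) ≠ 0 := by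
    exact_mod_cast (Int.natAbs_pos.2 (Rat.num_ne_zero.2 hneg.ne)).ne'
  have ht : R * ((q : ℚ).num.natAbs : ℚ) ≠ 0 := mul_ne_zero hR hN
  have hu' : u = (-1 : ℚˣ) ^ 3 * Units.mk0 ((R * ((q : ℚ).num.natAbs : ℚ)) ^ 2) (pow_ne_zero 2 ht) := by
    ext
    rw [hu, Units.val_mul, Units.val_pow_eq_pow_val, Units.val_mk0, Units.val_neg, Units.val_one, Nat.cast_one, mul_one,
      mul_natAbs_num_mul_den_eq_neg_sq hneg]
    ring
  rw [hu'] at hδ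
  exact isSplitWeilType_of_hasWeilDiscriminantNondeg_sq hW e ha ha0 ht hδ

end Split

end Literature.AlgebraicGeometry.VanGeemen1994

end
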